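import Literature.AlgebraicGeometry.Resolution.Lipman1969FormallySmoothBaseChange
import Literature.AlgebraicGeometry.Morphisms.CechH1FlatBaseChange
import HarnessLib

/-!
# Rational singularities ascend along flat local base change (Lipman 1969, Proposition (16.5),
# forward direction "A rational ⇒ B rational")

Topic: `Literature/AlgebraicGeometry/Resolution`.  PROVED forward half (R) of the named fact
`Lipman1969_16_5` of `Resolution/Lipman1969FormallySmoothBaseChange` (J. Lipman, *Rational
singularities, with applications to algebraic surfaces and unique factorization*, Publ. Math. IHÉS
36 (1969), Prop. (16.5), p. 235), in the `_of_16_1_ii` form: ASSUMING Lemma (16.1) (ii)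
(`Lipman1969_16_1_ii`: the base change `Z = Y ×_A Spec B → Spec B` of a desingularization
`Y → Spec A` is a desingularization), if `A` has a rational singularity then so has `B` — with the
binders of `Lipman1969_16_5` verbatim (the signature fixed by the W4.4 input census,
`F84_forward_halves_SIGNATURES.lean`).  One application of a future `Lipman1969_16_1_ii_holds` makes
it unconditional.

The proof is Lipman's (p. 235): "If `A` has a rational singularity then there is a
desingularization `g : Y → Spec(A)` with `H¹(Y, 𝒪_Y) = 0`.  Then `g_B : Z = Y ⊗_A B → Spec(B)` is a
desingularization of `B` (Lemma (16.1)) and since `B` is flat over `A`,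
`H¹(Z, 𝒪_Z) = H¹(Y, 𝒪_Y) ⊗_A B = 0`."  The cohomological input is the tree's flat base change of
Čech `Ȟ¹` in the vanishing case, `Morphisms/CechH1FlatBaseChange`
(`subsingleton_cechH1_of_isPullback_of_flat`: pull back a finite affine cover of the
quasi-compact separated `Y`, `Ȟ¹(g⁻¹𝒰, 𝒪_Z) = 0` by `Module.Flat.lTensor_exact`, then independence
of the affine cover on `Z`), packaged here as `HasTrivialCechH1.of_isPullback_of_flat` /
`HasTrivialCechH1.pullback_snd_of_flat`.  Only flatness of `A → B` and (16.1) (ii) are used: the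
hypotheses `ringKrullDim _ = 2` and normality of `A` are carried unused, as in the source ("and then
`A` has a rational singularity iff `B` has").

No new definitions, no named facts; resolution of singularities in dimension `≥ 4` /
characteristic `p` is NOT proved here, and no summit statement is proved here.

## References

* J. Lipman, *Rational singularities, with applications to algebraic surfaces and unique
  factorization*, Publ. Math. IHÉS 36 (1969) 195–279: Prop. (16.5), p. 235 (proof, first
  paragraph); Lemma (16.1) (ii), p. 231; Def. (1.1), p. 199. [Lipman1969]
* The Stacks Project, Tag 02KH (flat base change of cohomology). [StacksProject]
-/

noncomputable section

open CategoryTheory CategoryTheory.Limits AlgebraicGeometry TopologicalSpace IsLocalRing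
open Literature.AlgebraicGeometry.Morphisms

universe u

namespace Literature.AlgebraicGeometry.Resolution

/-! ## `H¹(X, 𝒪_X) = 0` ascends along flat base change of the affine base -/

/-- **`H¹ = 0` is preserved by flat base change** (`HasTrivialCechH1` form): for a cartesian square
`Z = X ×_{Spec A} Spec B` with `A → B` flat and `X` quasi-compact quasi-separated,
`H¹(X, 𝒪_X) = 0` implies `H¹(Z, 𝒪_Z) = 0` (Čech `Ȟ¹` of every finite affine open cover).
[cite: StacksProject, Tag 02KH (Cohomology of Schemes, Lemma 30.5.2: flat base change)] -/
theorem HasTrivialCechH1.of_isPullback_of_flat {A B : Type u} [CommRing A] [CommRing B]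
    [Algebra A B] [Module.Flat A B] {X Z : Scheme.{u}} {fX : X ⟶ Spec (.of A)}
    {fZ : Z ⟶ Spec (.of B)} {g : Z ⟶ X}
    (H : IsPullback g fZ fX (Spec.map (CommRingCat.ofHom (algebraMap A B))))
    [CompactSpace X] [QuasiSeparatedSpace X] (hX : HasTrivialCechH1 fX) :
    HasTrivialCechH1 fZ :=
  fun _ _ V hV hVcov => subsingleton_cechH1_of_isPullback_of_flat fX fZ g H hX V hV hVcov

/-- **`H¹ = 0` is preserved by flat base change**, for Mathlib's chosen pullback: if
`f : X → Spec A` is quasi-compact and quasi-separated with `H¹(X, 𝒪_X) = 0` and `A → B` is flat,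
then `X ×_{Spec A} Spec B → Spec B` has `H¹ = 0`.
[cite: StacksProject, Tag 02KH (Cohomology of Schemes, Lemma 30.5.2: flat base change)] -/
theorem HasTrivialCechH1.pullback_snd_of_flat {A B : Type u} [CommRing A] [CommRing B]
    [Algebra A B] [Module.Flat A B] {X : Scheme.{u}} (f : X ⟶ Spec (.of A)) [QuasiCompact f]
    [QuasiSeparated f] (hX : HasTrivialCechH1 f) :
    HasTrivialCechH1 (pullback.snd f (Spec.map (CommRingCat.ofHom (algebraMap A B)))) := by
  haveI : CompactSpace X := QuasiCompact.compactSpace_of_compactSpace f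
  haveI : QuasiSeparatedSpace X := quasiSeparatedSpace_of_quasiSeparated f
  exact HasTrivialCechH1.of_isPullback_of_flat (IsPullback.of_hasPullback f _) hX

/-! ## Proposition (16.5), "A rational ⇒ B rational" -/

/-- **Lipman 1969, Proposition (16.5), forward half (R): "A rational ⇒ B rational"**, in the
setting of `Lipman1969_16_5` (`A`, `B` Noetherian local, `A → B` local and flat, `𝔪_A B = 𝔪_B`,
`κ(B)/κ(A)` separable algebraic, `dim A = dim B = 2`, `A` reduced admitting a desingularization,
`A` normal) and conditionally on Lemma (16.1) (ii) (`h161 : Lipman1969_16_1_ii`).  Proof (p. 235):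
`HasRationalSingularity A` gives a desingularization `f : X → Spec A` with `H¹(X, 𝒪_X) = 0`; its
base change `X ×_A Spec B → Spec B` is a desingularization of `B` by (16.1) (ii), and has `H¹ = 0`
since `H¹` commutes with the flat base change `A → B` (`HasTrivialCechH1.pullback_snd_of_flat`).
[cite: Lipman1969, Proposition (16.5) (p. 235)] -/
theorem Lipman1969_16_5_rational_mp_of_16_1_ii (h161 : Lipman1969_16_1_ii.{u}) :
    ∀ (A B : Type u) [CommRing A] [CommRing B] [IsNoetherianRing A] [IsNoetherianRing B]
    [IsLocalRing A] [IsLocalRing B] [Algebra A B] [IsLocalHom (algebraMap A B)] [Module.Flat A B],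
    IsReduced A →
    (maximalIdeal A).map (algebraMap A B) = maximalIdeal B →
    Algebra.IsSeparable (ResidueField A) (ResidueField B) →
    ringKrullDim A = 2 → ringKrullDim B = 2 →
    (∃ (Y : Scheme.{u}) (g : Y ⟶ Spec (.of A)), IsResolution g) →
      (IsDomain A ∧ IsIntegrallyClosed A) → HasRationalSingularity A → HasRationalSingularity B := by
  intro A B _ _ _ _ _ _ _ _ _ hred hmax hsep _ _ _ _ hrat
  obtain ⟨X, f, hf, hH1⟩ := hrat
  obtain ⟨-, hres⟩ := h161 A B hred hmax hsep X f hf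
  haveI : IsProper f := hf.isProper
  exact ⟨_, _, hres, HasTrivialCechH1.pullback_snd_of_flat f hH1⟩

end Literature.AlgebraicGeometry.Resolution

end
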